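import Literature.RepresentationTheory.ModularTensorCategories.Pointed

/-!
# The semion modular datum `SU(2)_1`

Topic `Literature/RepresentationTheory/ModularTensorCategories` (definition item `defn-ModularDatum`:
"`semion = su2LevelK 1`" asked for by route `QuantumFields/ModularSelfDualFold`; the non-vacuity
witness of `ModularDatum`).

The semion theory (Rowell–Stong–Wang §5.3.1): labels `ℤ₂ = {1, s}`, `s ⊗ s = 1`, `d_s = 1`,
`θ_s = i`, `R^{ss}_1 = i`, `F^{sss}_s = -1`, `S = 2^{-1/2} [[1,1],[1,-1]]`, realised as the pointed
datum of the abelian 3-cocycle `ω(s,s,s) = -1`, `c(s,s) = i` on `ℤ₂` (`semionCocycle`, all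
identities checked case by case), `semion : PreModularDatum (ZMod 2)`, and upgraded to
`semionModular : ModularDatum (ZMod 2)` by verifying unitarity of `S`, `S² = C (= 1)` and the
Verlinde formula entrywise.
-/

noncomputable section

open scoped ComplexConjugate Matrix

namespace Literature.RepresentationTheory.ModularTensorCategories

/-- Every element of `ZMod 2` is `0` or `1`. [folklore] -/
theorem zmod_two_cases : ∀ x : ZMod 2, x = 0 ∨ x = 1 := by decide

/-- Arithmetic of `ZMod 2` used by `simp` below. [folklore] -/
theorem zmod_two_facts : ((0 : ZMod 2) ≠ 1) ∧ ((1 : ZMod 2) ≠ 0) ∧ ((1 : ZMod 2) + 1 = 0) ∧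
    ((0 : ZMod 2) - 1 = 1) ∧ (-(1 : ZMod 2) = 1) := by decide

/-- The **semion** abelian cocycle on `ℤ₂ = {0, s}`: `ω(s,s,s) = -1` (all other `ω = 1`),
`c(s,s) = i`. [cite: RowellStongWang2007, §5.3.1 (semion MTC: F^{sss}_s = -1, R^{ss}_1 = i)] -/
def semionCocycle : AbelianCocycle (ZMod 2) where
  ω := fun x y z => if x = 1 ∧ y = 1 ∧ z = 1 then -1 else 1
  c := fun x y => if x = 1 ∧ y = 1 then Complex.I else 1
  norm_ω := fun x y z => by split_ifs <;> simp
  norm_c := fun x y => by split_ifs <;> simp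
  ω_unit := fun x y z h => by
    have h01 := zmod_two_facts.1
    rcases h with rfl | rfl | rfl <;> simp [h01]
  c_unit_left := fun x => by simp [zmod_two_facts.1]
  c_unit_right := fun x => by simp [zmod_two_facts.1]
  cocycle := fun x y z w => by
    obtain ⟨h01, h10, h11, -, -⟩ := zmod_two_facts
    rcases zmod_two_cases x with rfl | rfl <;> rcases zmod_two_cases y with rfl | rfl <;>
      rcases zmod_two_cases z with rfl | rfl <;> rcases zmod_two_cases w with rfl | rfl <;>
        simp [h01, h11]
  hexagon := fun x y z => by
    obtain ⟨h01, h10, h11, -, -⟩ := zmod_two_facts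
    rcases zmod_two_cases x with rfl | rfl <;> rcases zmod_two_cases y with rfl | rfl <;>
      rcases zmod_two_cases z with rfl | rfl <;> simp [h01, h11]
  hexagon_inv := fun x y z => by
    obtain ⟨h01, h10, h11, -, -⟩ := zmod_two_facts
    rcases zmod_two_cases x with rfl | rfl <;> rcases zmod_two_cases y with rfl | rfl <;>
      rcases zmod_two_cases z with rfl | rfl <;> simp [h01, h11, Complex.inv_I]
  c_neg := fun x => by
    obtain ⟨h01, h10, h11, -, hn⟩ := zmod_two_facts
    rcases zmod_two_cases x with rfl | rfl <;> simp [h01, hn]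
  c_mul_c := fun x y => by
    obtain ⟨h01, h10, h11, -, -⟩ := zmod_two_facts
    rcases zmod_two_cases x with rfl | rfl <;> rcases zmod_two_cases y with rfl | rfl <;>
      simp [h01, h11]

/-- The **semion** premodular datum `SU(2)_1`: labels `ℤ₂`, `s ⊗ s = 1`, `d_s = 1`, `θ_s = i`,
`F^{sss}_s = -1`, `R^{ss}_1 = i`, `S = 2^{-1/2} [[1,1],[1,-1]]`.
[cite: RowellStongWang2007, §5.3.1 (semion MTC)] -/
def semion : PreModularDatum (ZMod 2) := semionCocycle.toPreModularDatum

/-- Sums over `ZMod 2`. [folklore] -/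
theorem sum_zmod_two {M : Type*} [AddCommMonoid M] (f : ZMod 2 → M) : ∑ x, f x = f 0 + f 1 :=
  Fin.sum_univ_two f

/-- The semion S-matrix entrywise: `S_{ab} = ± 2^{-1/2}`, minus exactly at `a = b = s`.
[cite: RowellStongWang2007, §5.3.1 (S-matrix of the semion)] -/
theorem semion_S_apply (a b : ZMod 2) :
    semion.S a b = (if a = 1 ∧ b = 1 then -1 else 1) / (Real.sqrt 2 : ℂ) := by
  change semionCocycle.sMatrix a b = _
  obtain ⟨h01, h10, h11, hs, hn⟩ := zmod_two_facts
  rcases zmod_two_cases a with rfl | rfl <;> rcases zmod_two_cases b with rfl | rfl <;>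
    simp [AbelianCocycle.sMatrix, semionCocycle, h01, hs, neg_div]

/-- `(√2)⁻¹ (√2)⁻¹ = 1/2` in `ℂ`. [folklore] -/
theorem inv_sqrt_two_mul_inv_sqrt_two :
    ((Real.sqrt 2 : ℝ) : ℂ)⁻¹ * ((Real.sqrt 2 : ℝ) : ℂ)⁻¹ = 1 / 2 := by
  rw [← mul_inv, ← Complex.ofReal_mul, Real.mul_self_sqrt zero_le_two]
  simp

/-- The **semion modular datum**: the semion premodular datum is modular — `S` unitary, `S² = C = 1`
and the Verlinde formula hold (direct `2 × 2` verification).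
[cite: RowellStongWang2007, §5.3.1 (semion MTC)] -/
def semionModular : ModularDatum (ZMod 2) where
  toPreModularDatum := semion
  S_unitary := by
    ext a b
    rw [Matrix.mul_apply, sum_zmod_two]
    simp only [Matrix.conjTranspose_apply, semion_S_apply]
    have h := inv_sqrt_two_mul_inv_sqrt_two
    obtain ⟨h01, h10, -, -, -⟩ := zmod_two_facts
    rcases zmod_two_cases a with rfl | rfl <;> rcases zmod_two_cases b with rfl | rfl <;>
      simp [h01, h10, div_eq_mul_inv] <;> linear_combination (2 : ℂ) * h
  S_mul_S := by
    ext a b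
    rw [Matrix.mul_apply, sum_zmod_two]
    simp only [semion_S_apply, Matrix.of_apply]
    have h := inv_sqrt_two_mul_inv_sqrt_two
    obtain ⟨h01, h10, -, -, hn⟩ := zmod_two_facts
    rcases zmod_two_cases a with rfl | rfl <;> rcases zmod_two_cases b with rfl | rfl <;>
      simp [semion, h01, h10, hn, div_eq_mul_inv] <;> linear_combination (2 : ℂ) * h
  verlinde := by
    intro a b c
    rw [sum_zmod_two]
    simp only [semion_S_apply]
    have h := inv_sqrt_two_mul_inv_sqrt_two
    obtain ⟨h01, h10, h11, -, -⟩ := zmod_two_facts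
    rcases zmod_two_cases a with rfl | rfl <;> rcases zmod_two_cases b with rfl | rfl <;>
      rcases zmod_two_cases c with rfl | rfl <;>
        simp [semion, h01, h10, h11, div_eq_mul_inv] <;>
          first | linear_combination (2 : ℂ) * h | linear_combination (-2 : ℂ) * h

end Literature.RepresentationTheory.ModularTensorCategories
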